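import Summits.BirchSwinnertonDyer.BirchSwinnertonDyer.Theorems.ManinLocalTwoThreeUnboundedDenominatorsWeightOfCDT
import Summits.BirchSwinnertonDyer.BirchSwinnertonDyer.Theorems.ManinLocalTwoThreeKummerCoverSubgroup
import Summits.BirchSwinnertonDyer.BirchSwinnertonDyer.Theorems.ManinLocalTwoThreeKummerCoverNotGammaOne
import Summits.BirchSwinnertonDyer.BirchSwinnertonDyer.Theorems.ManinLocalTwoThreeKummerCubeRootThreeBounded
import Summits.BirchSwinnertonDyer.BirchSwinnertonDyer.Theorems.ManinLocalTwoThreeIntegralQSeriesNearCusp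
import Summits.BirchSwinnertonDyer.BirchSwinnertonDyer.Theorems.ManinLocalTwoThreeIntegralQSeriesNearCuspB
import Summits.BirchSwinnertonDyer.BirchSwinnertonDyer.Theorems.ManinLocalTwoThreeKummerMinimalDictionary
import Summits.BirchSwinnertonDyer.BirchSwinnertonDyer.Theorems.ManinLocalTwoThreeKummerMinimalParamPresentation
import Summits.BirchSwinnertonDyer.BirchSwinnertonDyer.Theorems.ManinLocalTwoThreeKummerWitnessExtensionB
import Summits.BirchSwinnertonDyer.BirchSwinnertonDyer.Theorems.ManinLocalTwoThreeKummerWitnessInvarianceB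
import Summits.BirchSwinnertonDyer.BirchSwinnertonDyer.Theorems.ManinLocalTwoThreeKummerWitnessInvariance
import Summits.BirchSwinnertonDyer.BirchSwinnertonDyer.Theorems.ManinLocalTwoThreeKummerPoleValuesAlgebraic
import Summits.BirchSwinnertonDyer.BirchSwinnertonDyer.Theorems.ManinLocalTwoThreeQExpansionExtension
import Summits.BirchSwinnertonDyer.Rank1Residual.ManinAdditive.UDCKummerWitnessLineB
import Summits.BirchSwinnertonDyer.Rank1Residual.ManinAdditive.UDCKummerWitnessLineHolds
import HarnessLib

/-!
# C3 BY NAME ON THE B-LINE: `ManinPrimeToThreeAtNine` ⟸ F₃♮ ∧ CDT ∧ (RATB) ∧ RES₃♭ — every other node a THEOREM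
(route `ManinLocalTwoThree`, crux C3 `ManinPrimeToThreeAtNine` stmt-BirchSwinnertonDyer-22968; cell bsd-f2-manin, C3 LEAD p1 gen 16;
`--supports stmt-BirchSwinnertonDyer-22968`; the sorry-free image of the lead's registered skeleton `Lines/kato_shift_three.lean` v27)

The C3 skeleton v27 runs -an g38's WITNESS LAW (WL♭) `UDCKummerWitnessLine.KummerCubeRootModularFormWitnessNearCusp` on the B-LINE
(`UDCKummerWitnessLineB.lean`, p730675): (INT) → (DICT) → (RATB) → (HOLB) → (QEXNB) → (INVB) → (WL♭).  Five of the six pieces are THEOREMS in the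
tree — (INT) `IntegralQSeries.minimalKummerCubeRootIntegral_holds` (p3 p728452 / lead p730250), (DICT) `MinimalDictionary.kummerMinimalDictionary_holds`
(lead p733079), (HOLB) `WitnessInvariance.kummerMinimalWitnessExtensionB_holds` (p2 p731758), (QEXNB) `IntegralQSeries.integralQSeriesNearCuspB_holds`
(lead p732744), (INVB) `WitnessInvariance.kummerMinimalWitnessInvarianceB_holds` (p2 p731884) — so this file records, WITHOUT `sorry`:

* `kummerCubeRootModularFormWitnessNearCusp_of_paramPresentation : (RATB) → (WL♭)`,
  `kummerCubeRootModularFormWitness_of_paramPresentation : (RATB) → (WL)` ((QXP) `qExpansionExtensionPrinciple_holds`, p730253),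
  `kummerCubeRootCongruenceOfBoundedOfUDC_of_paramPresentation : (RATB) → (AN♮)` (the lead's relaxed UDC glue p729478 ∘ p727487);
* the P(j)-line twin `kummerCubeRootModularFormWitnessNearCusp_of_witnessExtension : (EXT) → (WL♭)` ((ALG) p3 p731971, (DICT), (QEXN) p730250,
  (INV) p2 p731378 by name) — either of (RATB) [p3 g16 TAKING] or (EXT) closes the witness law;
* **`maninPrimeToThreeAtNine_of_katoFactKP_of_CDT_of_paramPresentation_of_coprimeIsolated :
  F₃♮ → CDT → (RATB) → RES₃♭ → ManinLocalTwoThree.ManinPrimeToThreeAtNine`** — p2's `UDWOfCDT.maninPrimeToThreeAtNine_of_katoFactKP_of_CDT_udcNine_of_coprimeIsolated`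
  fed with the THEOREMS (NC-a) `kummerCoverSubgroup_holds` (lead p725557), (NC-b)@9 `KummerCover.exists_mem_gamma1_not_kummerPeriodTrivial` (p3),
  (BI) `KummerCubeRootBounded.kummerCubeRoot_threeAdicallyBounded` (p3) and (AN♮) from (RATB).

HONEST FRAMING.  This is a CONDITIONAL reduction, kernel-checked: the four hypotheses are F₃♮ = Kato's `p = 3` divisibility in Kosters–Pannekoek form
(`kato_neron_isIntegral_twistedSymbolSum_of_additive_three_kp`, PRINTED, statement-only), CDT = Calegari–Dimitrov–Tang 2025 Thm. 1.0.1
(`CalegariDimitrovTang2025_unboundedDenominators`, PRINTED, statement-only), (RATB) = an analytic bookkeeping statement being proved by p3, and RES₃♭ =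
the cell's census residual `NoRationalThreeTorsionCoprimeIsolatedResidual` (an instance of Manin's conjecture itself; OPEN).  C3 is NOT proved; Manin's
conjecture is NOT proved; BSD is NOT proved by this.  No definitions, no sorry.
[cite: CalegariDimitrovTang2025, Thm. 1.0.1] [cite: Kato2004Asterisque, Thm. 9.7 (p. 189)]
-/

set_option autoImplicit false
-- lint-debt: the directory name repeats the summit name (sibling precedent `ManinLocalTwoThreeUDCLineAtNine.lean`)
set_option linter.dupNamespace false

noncomputable section

open scoped MatrixGroups
open CongruenceSubgroup
open Literature.NumberTheory.EllipticCurves Literature.NumberTheory.EllipticCurves.ModularForms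
open Summit.BirchSwinnertonDyer.Rank1Residual.ManinAdditive.CuspidalKummerThree
open Summit.BirchSwinnertonDyer.Rank1Residual.ManinAdditive.UDCKummerLine
open Summit.BirchSwinnertonDyer.Rank1Residual.ManinAdditive.UDCKummerWitnessLine

namespace Summit.BirchSwinnertonDyer.BirchSwinnertonDyer.Theorems.ManinLocalTwoThree.UDCBLine

/-! ### §1 The witness law from ONE remaining piece -/

/-- **(RATB) ⟹ (WL♭)** on the B-line: (INT), (DICT), (HOLB), (QEXNB), (INVB) are theorems by name. [folklore] -/
theorem kummerCubeRootModularFormWitnessNearCusp_of_paramPresentation (hRATB : KummerMinimalParamPresentation) :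
    KummerCubeRootModularFormWitnessNearCusp :=
  kummerCubeRootModularFormWitnessNearCusp_of_piecesB IntegralQSeries.minimalKummerCubeRootIntegral_holds
    MinimalDictionary.kummerMinimalDictionary_holds hRATB WitnessInvariance.kummerMinimalWitnessExtensionB_holds
    IntegralQSeries.integralQSeriesNearCuspB_holds WitnessInvariance.kummerMinimalWitnessInvarianceB_holds

/-- **(RATB) ⟹ (WL)** (the unrelaxed law, (QXP) discharged by `IntegralQSeries.qExpansionExtensionPrinciple_holds`). [folklore] -/
theorem kummerCubeRootModularFormWitness_of_paramPresentation (hRATB : KummerMinimalParamPresentation) :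
    KummerCubeRootModularFormWitness :=
  kummerCubeRootModularFormWitness_of_nearCusp (kummerCubeRootModularFormWitnessNearCusp_of_paramPresentation hRATB)
    IntegralQSeries.qExpansionExtensionPrinciple_holds

/-- **(RATB) ⟹ (AN♮)** `KummerCubeRootCongruenceOfBoundedOfUDC` (the lead's relaxed UDC glue
`UDCGlue.kummerCubeRootCongruenceOfBoundedOfUDC_of_modularFormWitness_of_lt_im`). [folklore] -/
theorem kummerCubeRootCongruenceOfBoundedOfUDC_of_paramPresentation (hRATB : KummerMinimalParamPresentation) :
    KummerCubeRootCongruenceOfBoundedOfUDC :=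
  UDCGlue.kummerCubeRootCongruenceOfBoundedOfUDC_of_modularFormWitness_of_lt_im
    (kummerCubeRootModularFormWitnessNearCusp_of_paramPresentation hRATB)

/-- **(EXT) ⟹ (WL♭)** on the P(j)-line (the alternative): (INT), (ALG), (DICT), (QEXN), (INV) are theorems by name. [folklore] -/
theorem kummerCubeRootModularFormWitnessNearCusp_of_witnessExtension (hEXT : KummerMinimalWitnessExtension) :
    KummerCubeRootModularFormWitnessNearCusp :=
  kummerCubeRootModularFormWitnessNearCusp_of_pieces IntegralQSeries.minimalKummerCubeRootIntegral_holds
    ParamPoleJ.kummerPoleValuesAlgebraic_holds MinimalDictionary.kummerMinimalDictionary_holds hEXT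
    IntegralQSeries.integralQSeriesNearCusp_holds WitnessInvariance.kummerMinimalWitnessInvariance_holds

/-! ### §2 C3 from the four remaining inputs -/

/-- (NC-b)@9 in the shape p2's composition consumes (p3's `KummerCover.exists_mem_gamma1_not_kummerPeriodTrivial`; the binders `u ∉ Λ`,
`c³℘'(u)/2 = Y₀` are not needed). [folklore] -/
theorem kummerCoverNotGammaOneAtNine :
    ∀ (W : WeierstrassCurve ℚ) [W.IsElliptic] [W.IsGloballyMinimal] {N : ℕ} [NeZero N]
      (D : ModularParametrizationData W N),
      (∀ z ∈ D.L.lattice, ∃ w ∈ periodLattice D.f, z = D.c * w) → 9 ∣ N →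
      ∀ X₀ Y₀ : ℚ, IsShortThreeTorsion W D.c X₀ Y₀ →
      ∀ u : ℂ, u ∉ D.L.lattice → 3 * u ∈ D.L.lattice →
      (D.c : ℂ) ^ 2 * D.L.weierstrassP u = (X₀ : ℂ) → (D.c : ℂ) ^ 3 * D.L.derivWeierstrassP u / 2 = (Y₀ : ℂ) →
      ∃ γ : Gamma0 N, (γ : SL(2, ℤ)) ∈ Gamma1 N ∧ ¬ KummerPeriodTrivial D u γ :=
  fun W _ _ _ _ D hopt h9 X₀ Y₀ hT u _ h3u hX _ ↦
    KummerCover.exists_mem_gamma1_not_kummerPeriodTrivial W D h9 hopt X₀ Y₀ hT u h3u hX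

/-- **C3 `ManinPrimeToThreeAtNine` ⟸ F₃♮ ∧ CDT ∧ (RATB) ∧ RES₃♭** (skeleton v27 of line `kato_shift_three`, sorry-free image): p2's
`UDWOfCDT.maninPrimeToThreeAtNine_of_katoFactKP_of_CDT_udcNine_of_coprimeIsolated` with (NC-a), (NC-b)@9, (BI) theorems by name and (AN♮) from (RATB).
CONDITIONAL reduction; C3 OPEN; BSD is not proved by this. [cite: CalegariDimitrovTang2025, Thm. 1.0.1] [cite: Kato2004Asterisque, Thm. 9.7 (p. 189)] -/
theorem maninPrimeToThreeAtNine_of_katoFactKP_of_CDT_of_paramPresentation_of_coprimeIsolated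
    (hK : kato_neron_isIntegral_twistedSymbolSum_of_additive_three_kp)
    (hCDT : Literature.NumberTheory.Automorphic.CalegariDimitrovTang2025_unboundedDenominators)
    (hRATB : KummerMinimalParamPresentation) (hRes : NoRationalThreeTorsionCoprimeIsolatedResidual) :
    Summit.BirchSwinnertonDyer.BirchSwinnertonDyer.Theses.ManinLocalTwoThree.ManinPrimeToThreeAtNine :=
  UDWOfCDT.maninPrimeToThreeAtNine_of_katoFactKP_of_CDT_udcNine_of_coprimeIsolated hK hCDT kummerCoverSubgroup_holds
    kummerCoverNotGammaOneAtNine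
    (fun W _ _ _ _ D a ha h9 X₀ Y₀ hT z hz h3c ↦
      KummerCubeRootBounded.kummerCubeRoot_threeAdicallyBounded W D a ha h9 X₀ Y₀ hT z hz h3c)
    (kummerCubeRootCongruenceOfBoundedOfUDC_of_paramPresentation hRATB) hRes

/-- **C3 ⟸ F₃♮ ∧ CDT ∧ (EXT) ∧ RES₃♭** — the P(j)-line variant. CONDITIONAL reduction; C3 OPEN; BSD is not proved by this.
[cite: CalegariDimitrovTang2025, Thm. 1.0.1] [cite: Kato2004Asterisque, Thm. 9.7 (p. 189)] -/
theorem maninPrimeToThreeAtNine_of_katoFactKP_of_CDT_of_witnessExtension_of_coprimeIsolated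
    (hK : kato_neron_isIntegral_twistedSymbolSum_of_additive_three_kp)
    (hCDT : Literature.NumberTheory.Automorphic.CalegariDimitrovTang2025_unboundedDenominators)
    (hEXT : KummerMinimalWitnessExtension) (hRes : NoRationalThreeTorsionCoprimeIsolatedResidual) :
    Summit.BirchSwinnertonDyer.BirchSwinnertonDyer.Theses.ManinLocalTwoThree.ManinPrimeToThreeAtNine :=
  UDWOfCDT.maninPrimeToThreeAtNine_of_katoFactKP_of_CDT_udcNine_of_coprimeIsolated hK hCDT kummerCoverSubgroup_holds
    kummerCoverNotGammaOneAtNine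
    (fun W _ _ _ _ D a ha h9 X₀ Y₀ hT z hz h3c ↦
      KummerCubeRootBounded.kummerCubeRoot_threeAdicallyBounded W D a ha h9 X₀ Y₀ hT z hz h3c)
    (UDCGlue.kummerCubeRootCongruenceOfBoundedOfUDC_of_modularFormWitness_of_lt_im
      (kummerCubeRootModularFormWitnessNearCusp_of_witnessExtension hEXT)) hRes

/-! ### §3 (appended, lead p1 gen 16 after p3's (RATB) p733689) — the witness law and C3's UDC line with NO analytic hypothesis left -/

/-- **(WL♭) is a THEOREM**: all six B-line pieces by name ((RATB) = p3's `ParamPoleJ.kummerMinimalParamPresentation_holds`, p733689). [folklore] -/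
theorem kummerCubeRootModularFormWitnessNearCusp_of_tree : KummerCubeRootModularFormWitnessNearCusp :=
  kummerCubeRootModularFormWitnessNearCusp_of_paramPresentation ParamPoleJ.kummerMinimalParamPresentation_holds

/-- **(WL) is a THEOREM** (the C3 LEAD's v23 witness stub `stub_kummerCubeRootModularFormWitness`, now closed). [folklore] -/
theorem kummerCubeRootModularFormWitness_of_tree : KummerCubeRootModularFormWitness :=
  kummerCubeRootModularFormWitness_of_paramPresentation ParamPoleJ.kummerMinimalParamPresentation_holds

/-- **(AN♮) is a THEOREM**: `KummerCubeRootCongruenceOfBoundedOfUDC` — given Unbounded Denominators in every weight, a `3`-adically bounded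
normalised cube root of the tangent-line Kummer series forces a Kummer-trivial period in `Γ₁(N)`-position (contradicting NC-b). [folklore] -/
theorem kummerCubeRootCongruenceOfBoundedOfUDC_of_tree : KummerCubeRootCongruenceOfBoundedOfUDC :=
  kummerCubeRootCongruenceOfBoundedOfUDC_of_paramPresentation ParamPoleJ.kummerMinimalParamPresentation_holds

/-- **C3 `ManinPrimeToThreeAtNine` ⟸ F₃♮ ∧ CDT ∧ RES₃♭ — the registered skeleton v28 of line `kato_shift_three`, sorry-free**: every analytic / algebraic
node of the UDC line is a theorem; the three hypotheses are Kato's `p = 3` divisibility (PRINTED, statement-only), Calegari–Dimitrov–Tang 2025 Thm. 1.0.1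
(PRINTED, statement-only) and the cell's census residual RES₃♭ (OPEN).  CONDITIONAL reduction; C3 is NOT proved; BSD is NOT proved by this.
[cite: CalegariDimitrovTang2025, Thm. 1.0.1] [cite: Kato2004Asterisque, Thm. 9.7 (p. 189)] -/
theorem maninPrimeToThreeAtNine_of_katoFactKP_of_CDT_of_coprimeIsolated
    (hK : kato_neron_isIntegral_twistedSymbolSum_of_additive_three_kp)
    (hCDT : Literature.NumberTheory.Automorphic.CalegariDimitrovTang2025_unboundedDenominators)
    (hRes : NoRationalThreeTorsionCoprimeIsolatedResidual) :
    Summit.BirchSwinnertonDyer.BirchSwinnertonDyer.Theses.ManinLocalTwoThree.ManinPrimeToThreeAtNine :=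
  maninPrimeToThreeAtNine_of_katoFactKP_of_CDT_of_paramPresentation_of_coprimeIsolated hK hCDT
    ParamPoleJ.kummerMinimalParamPresentation_holds hRes

end Summit.BirchSwinnertonDyer.BirchSwinnertonDyer.Theorems.ManinLocalTwoThree.UDCBLine

end
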